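import Mathlib
import Summits.Ventures.PercRepro.TriangleCapRowFour
import Summits.Ventures.PercRepro.TriangleCapStabTableEvery
import Summits.Ventures.PercRepro.TriangleCapFourRowTwoSecondBest
import Summits.Ventures.PercRepro.TriangleCapFourRowThreeSecondBest

/-!
# PercRepro — THE STABILITY TABLE OF THE ROW `a = 4`, AND OF EVERY ROW `a ≥ 4` (p3, gen 49; part 206)

`stabGapFull k 4 r` IS the row-4 gap: `2 (k − 9)(4 − r)` at `r ≤ 1`, `2 (k − 9)` at `r = 2, 3`
(`2 k − 18 = 2 (k − 9)`), `2 k − 14 + 2 (r − 4)` at `r ≥ 4` (the one-triangle gap, `min` attained on the second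
branch). So the row `a = 4` (`below_nonbip_second_best_every`, `four_two_nonbip_second_best`,
`four_three_nonbip_second_best`, `rowFour_nonbip_second_best`) joins `stab_table_every`:

* `stab_table_four` — the row `a = 4` on every cell `r ≥ 0`, `8 + r ≤ k`, `10 ≤ k`;
* `stab_table_rows_ge_four` — **the whole table for every row `a ≥ 4`** (`2 a + r ≤ k`, `2 a + 2 ≤ k`);
* `cherry_second_best_four` / `cherry_second_best_all` — the second best among ALL graphs (`≠` the closed form) is
  the broom value `2 (r − 2)` for `r ≥ 3`, every row `a ≥ 4`.

Axioms: standard.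
-/

namespace PercRepro

namespace TriangleCap

namespace C047

open Finset

/-- `stabGapFull k 4 r = 2 (k − 2·4 − 1)(4 − r)` for `r ≤ 1`. -/
theorem stabGapFull_four_lo (k r : ℕ) (hr : r ≤ 1) : stabGapFull k 4 r = 2 * (k - 2 * 4 - 1) * (4 - r) := by
  unfold stabGapFull
  rw [if_pos (by omega)]

/-- `stabGapFull k 4 r = 2 (k − 9)` for `r = 2, 3`. -/
theorem stabGapFull_four_mid (k r : ℕ) (hr : 2 ≤ r) (hr3 : r ≤ 3) : stabGapFull k 4 r = 2 * (k - 9) := by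
  unfold stabGapFull
  rw [if_neg (by omega), if_pos (by omega)]
  omega

/-- `stabGapFull k 4 (4 + j) = 2 k − 14 + 2 j (4 − 3)` for `10 ≤ k`. -/
theorem stabGapFull_four_hi (k j : ℕ) (hk : 10 ≤ k) :
    stabGapFull k 4 (4 + j) = 2 * k - 14 + 2 * j * (4 - 3) := by
  unfold stabGapFull
  rw [if_neg (by omega), if_neg (by omega)]
  have h1 : 4 + j - 4 = j := by omega
  rw [h1]
  apply min_eq_right
  simp only [show (4 : ℕ) - 3 = 1 from rfl, show (4 : ℕ) - 2 = 2 from rfl, mul_one]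
  omega

/-- **THE STABILITY TABLE OF THE ROW `a = 4`** on every cell `(k, 4, r)`, `8 + r ≤ k`, `10 ≤ k`: every
non-`4`-bipartite `K₄⁻`-free graph with `m + r = 4 (k − 4)` edges satisfies `Σ d² + r (k − 1 − r) + stabGapFull k 4 r ≤
m k`, and some non-`4`-bipartite one attains it. -/
theorem stab_table_four (k r : ℕ) (hk : 8 + r ≤ k) (hk2 : 10 ≤ k) :
    (∀ (D : SimpleGraph (Fin k)) [DecidableRel D.Adj], K4mFree D → D.edgeFinset.card + r = 4 * (k - 4) →
        (¬ ∃ A : Finset (Fin k), A.card = 4 ∧ BipSub D A) →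
        ∑ v, deg D v * deg D v + r * (k - 1 - r) + stabGapFull k 4 r ≤ D.edgeFinset.card * k) ∧
      ∃ (D : SimpleGraph (Fin k)) (_ : DecidableRel D.Adj), K4mFree D ∧ D.edgeFinset.card + r = 4 * (k - 4) ∧
        (¬ ∃ A : Finset (Fin k), A.card = 4 ∧ BipSub D A) ∧
        ∑ v, deg D v * deg D v + r * (k - 1 - r) + stabGapFull k 4 r = D.edgeFinset.card * k := by
  by_cases hr1 : r ≤ 1
  · rw [stabGapFull_four_lo k r hr1]
    exact below_nonbip_second_best_every k 4 r (le_refl 4) (by omega) (by omega) (by omega)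
  by_cases hr3 : r ≤ 3
  · rw [stabGapFull_four_mid k r (by omega) hr3]
    rcases (show r = 2 ∨ r = 3 by omega) with rfl | rfl
    · have e : k - 1 - 2 = k - 3 := by omega
      rw [e]
      exact four_two_nonbip_second_best k hk2
    · have e1 : k - 1 - 3 = k - 4 := by omega
      have e2 : 2 * (k - 9) = 2 * k - 18 := by omega
      rw [e1, e2]
      exact four_three_nonbip_second_best k (by omega)
  · obtain ⟨j, rfl⟩ : ∃ j, r = 4 + j := ⟨r - 4, by omega⟩
    rw [stabGapFull_four_hi k j hk2]
    exact rowFour_nonbip_second_best k j (by omega)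

/-- **THE WHOLE STABILITY TABLE FOR EVERY ROW `a ≥ 4`** (`2 a + r ≤ k`, `2 a + 2 ≤ k`), with no bound on `a`:
the non-`a`-bipartite second best of the `K₄⁻`-free cherry table on the cell `(k, a, r)` is the closed form minus
`stabGapFull k a r`, attained. -/
theorem stab_table_rows_ge_four (k a r : ℕ) (ha4 : 4 ≤ a) (hk : 2 * a + r ≤ k) (hk2 : 2 * a + 2 ≤ k) :
    (∀ (D : SimpleGraph (Fin k)) [DecidableRel D.Adj], K4mFree D → D.edgeFinset.card + r = a * (k - a) →
        (¬ ∃ A : Finset (Fin k), A.card = a ∧ BipSub D A) →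
        ∑ v, deg D v * deg D v + r * (k - 1 - r) + stabGapFull k a r ≤ D.edgeFinset.card * k) ∧
      ∃ (D : SimpleGraph (Fin k)) (_ : DecidableRel D.Adj), K4mFree D ∧ D.edgeFinset.card + r = a * (k - a) ∧
        (¬ ∃ A : Finset (Fin k), A.card = a ∧ BipSub D A) ∧
        ∑ v, deg D v * deg D v + r * (k - 1 - r) + stabGapFull k a r = D.edgeFinset.card * k := by
  rcases Nat.eq_or_lt_of_le ha4 with rfl | h5
  · exact stab_table_four k r (by omega) (by omega)
  · exact stab_table_every k a r h5 hk hk2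

/-- **THE SECOND BEST AMONG ALL GRAPHS ON THE ROW `a = 4`, `r ≥ 3`:** the broom value `2 (r − 2)` below the closed
form, attained (the non-bipartite gap `stabGapFull k 4 r ≥ 2 (r − 2)` for `8 + r ≤ k`). -/
theorem cherry_second_best_four (k r : ℕ) (hr3 : 3 ≤ r) (hk : 8 + r ≤ k) :
    (∀ (D : SimpleGraph (Fin k)) [DecidableRel D.Adj], K4mFree D → D.edgeFinset.card + r = 4 * (k - 4) →
        ∑ v, deg D v * deg D v + r * (k - 1 - r) ≠ D.edgeFinset.card * k →
        ∑ v, deg D v * deg D v + r * (k - 1 - r) + 2 * (r - 2) ≤ D.edgeFinset.card * k) ∧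
      ∃ (D : SimpleGraph (Fin k)) (_ : DecidableRel D.Adj), K4mFree D ∧ D.edgeFinset.card + r = 4 * (k - 4) ∧
        ∑ v, deg D v * deg D v + r * (k - 1 - r) + 2 * (r - 2) = D.edgeFinset.card * k := by
  have hcard : Fintype.card (Fin k) = k := Fintype.card_fin k
  refine ⟨?_, ?_⟩
  · intro D _ hK hm hne
    by_cases hnb : ∃ A : Finset (Fin k), A.card = 4 ∧ BipSub D A
    · obtain ⟨A, hAcard, hB⟩ := hnb
      by_cases hstar : ∃ v, MissingStar D A v
      · obtain ⟨v, hv⟩ := hstar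
        have h := closed_form_eq_of_missingStar D A hB hv 4 r hAcard (by rw [hcard]; exact hm)
          (by rw [hcard]; omega)
        rw [hcard] at h
        exact absurd h hne
      · have h := closed_form_stability_bipSub D A hB 4 r hAcard (by rw [hcard]; exact hm) (by rw [hcard]; omega)
          (by omega) hstar
        rw [hcard] at h
        exact h
    · have h := (stab_table_four k r hk (by omega)).1 D hK hm hnb
      have hge : 2 * (r - 2) ≤ stabGapFull k 4 r := by
        by_cases hr3' : r ≤ 3
        · rw [stabGapFull_four_mid k r (by omega) hr3']
          omega
        · obtain ⟨j, rfl⟩ : ∃ j, r = 4 + j := ⟨r - 4, by omega⟩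
          rw [stabGapFull_four_hi k j (by omega)]
          simp only [show (4 : ℕ) - 3 = 1 from rfl, mul_one]
          omega
      omega
  · obtain ⟨D, inst, A, hK, hAcard, hB, hns, hE, hS⟩ := broom_value k 4 r (by omega) hr3 (by omega)
    have hr' : r ≤ 4 * (k - 4) := by
      have h2 : 1 * (k - 4) ≤ 4 * (k - 4) := Nat.mul_le_mul_right _ (by omega)
      omega
    have hE' : D.edgeFinset.card + r = 4 * (k - 4) := by rw [hE]; omega
    refine ⟨D, inst, hK, hE', ?_⟩
    rw [hE]
    exact hS

/-- **THE SECOND BEST AMONG ALL GRAPHS FOR EVERY ROW `a ≥ 4`, `r ≥ 3`, `2 a + r ≤ k`:** the broom value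
`2 (r − 2)` below the closed form, attained. -/
theorem cherry_second_best_all (k a r : ℕ) (ha4 : 4 ≤ a) (hr3 : 3 ≤ r) (hk : 2 * a + r ≤ k) :
    (∀ (D : SimpleGraph (Fin k)) [DecidableRel D.Adj], K4mFree D → D.edgeFinset.card + r = a * (k - a) →
        ∑ v, deg D v * deg D v + r * (k - 1 - r) ≠ D.edgeFinset.card * k →
        ∑ v, deg D v * deg D v + r * (k - 1 - r) + 2 * (r - 2) ≤ D.edgeFinset.card * k) ∧
      ∃ (D : SimpleGraph (Fin k)) (_ : DecidableRel D.Adj), K4mFree D ∧ D.edgeFinset.card + r = a * (k - a) ∧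
        ∑ v, deg D v * deg D v + r * (k - 1 - r) + 2 * (r - 2) = D.edgeFinset.card * k := by
  rcases Nat.eq_or_lt_of_le ha4 with rfl | h5
  · exact cherry_second_best_four k r hr3 (by omega)
  · exact cherry_second_best_every k a r h5 hr3 hk

end C047

end TriangleCap

end PercRepro
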